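import Literature.NumberTheory.EllipticCurves.BertoliniDarmonPrasanna2013.DisplayWeightTwo
import Summits.BirchSwinnertonDyer.Rank1Residual.X11b.Three.UnrSeriesTwistCharacter
import Summits.BirchSwinnertonDyer.Rank1Residual.X11b.UnrIntegersUnitPowers
import Literature.NumberTheory.NumberFields.ClassGroupPrimesAvoiding
import Literature.NumberTheory.GaloisRepresentations.ArtinCharacterReciprocity
import Literature.NumberTheory.GaloisRepresentations.IntegralGaloisActionProofs
import HarnessLib

/-!
# The BDP-display ↦ Castella-display rescaling and its three analytic inputs (CRT pair, uniform
# convergence of avatars through `κ`, `ι⁻¹(φ_k(𝔟)) → 1`) — lemmas for `X2/NonsplitBDPValueDisplayPNew.lean`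
# (cell `bsd-eis`, seat `bsd-eis-k5-c4`; route `EisensteinPrimes`, crux 4 `BSDpOnCellC` =
# stmt-BirchSwinnertonDyer-19034, line b1, atom c2¬split at `p ≥ 5`; RULING L11 (O2), k5-c4-MEMO-1 (B2))

HONEST FRAMING (cell `bsd-eis`): theorems only; nothing booked; X2 stays CONSTRUCTION-SHAPED; no label
moves; BSD is not proved by any of this. No elliptic curve occurs in this file: it is the algebra and
the `p`-adic analysis behind reading (R2) of k5-c4-MEMO-1 — «BDP 2013's constants
`w(f,χ)⁻¹C(f,χ,1)/Ω^{4n}` (Thm. 4.6, (5.1.11), Thm. 5.5) and Castella's `Γ(n)Γ(n+1)/(π^{2n+1}Ω_K^{4n})`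
(`bdpInterpolationValue`) differ by `(const)^n`, absorbed by a virtual period, and a `p`-adic unit» —
which the planner's RULING L11 (2026-08-26T07:15:24Z) placed IN THE KERNEL rather than in a docstring.

* §1 `exists_mul_eq_span_and_isCoprime` — the auxiliary pair `(𝔟, b_N)` of BDP (5.1.6) (`𝔟𝔑 = (b_N)`,
  `𝔟` prime to a given nonzero ideal) by the Chinese remainder theorem, prime by prime
  (`ClassGroup.exists_mul_eq_span_and_forall_not_mem`).
* §2 `eventually_forall_norm_avatarValueAt_sub_one_lt` — for rank-one characters through a
  `ℤ_p`-extension `κ`, convergence `r_k(γ) → 1` at a topological generator is UNIFORM convergence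
  `r_k → 1` on `Γ_K` (`X11b.Halves.exists_addChar_of_factorsThroughZp`; `‖χ(a) − 1‖ ≤ ‖χ(1) − 1‖` on the
  dense `ℕ ⊂ ℤ_p` by `X11b.UnrUnits.norm_pow_sub_one_le`) — so the tree's interpolation sequences converge in BDP's topology
  of `Σ̂_cc(𝔑)` (uniform convergence of `p`-adic avatars, BDP 2013 p. 61).
* §3 `tendsto_symm_heckeIdealValue` — `ι⁻¹(φ_k(𝔟)) → 1` for `𝔟` prime to `p` along such a sequence: at
  each prime `v ∣ 𝔟` an arithmetic Frobenius `Φ_v` has `r_k(Φ_v) = ι⁻¹(φ_k(ϖ_v))⁻¹` (`IsPAdicAvatarOf` in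
  rank one; `exists_isArithFrobAt_of_mem_primesAbove_holds`); finite product over the factorisation
  (`heckeIdealValueExtZero_eq_prod`).
* §4 `eulerSq_mul_bdpLalg_eq` — THE RESCALING: `(1 − a_p p⁻¹φ(𝔭))²·L_alg(f,χ⁻¹,0) =
  bdpInterpolationValue p f 𝔭 φ n Ω_K′ · g/(w_f·φ(𝔟))`, `Ω_K′⁴ = Ω⁴·N𝔟·(−N₀)·|d_K|/(4π⁴ b_N²)`,
  `g = (1/4)·w_K·|d_K|^{1/2}·2^{#S(f)}`: every `n`-th power — `π^{4n}`, `(4/|d_K|)^n`,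
  `(N𝔟(−N₀)/b_N²)^n`, `(Ω_K′/Ω)^{4n}` — is absorbed EXACTLY (BDP Rem. 5.6 / 5.8); the Γ-factors match.
* §5 `norm_map_natCast_eq_one`, `norm_map_sqrt_discr_eq_one` — the `p`-adic norms of the leftover
  constants read through `ι⁻¹ : ℂ → ℂ_p` (`‖n‖ = 1` for `p ∤ n`; `‖|d_K|^{1/2}‖² = ‖d_K‖_p`).

References: [BertoliniDarmonPrasanna2013] (4.1.5), Thm. 4.6, (5.1.6), (5.1.11), Thm. 5.5, Rem. 5.6, §5.2
(p. 61, Rem. 5.8); [Castella2018] Thm. 3.1 (the display); [SerreAbelianLadic1968] Ch. II §2.7;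
[NeukirchANT1999] Ch. I §3.
-/

noncomputable section

namespace Summit.BirchSwinnertonDyer.Rank1Residual.X2

open scoped Classical MatrixGroups ModularForm Topology
open Filter CongruenceSubgroup NumberField IsDedekindDomain Field
open Literature Literature.NumberTheory.EllipticCurves Literature.NumberTheory.GaloisRepresentations
open Literature.NumberTheory.EllipticCurves.ModularForms
open Literature.NumberTheory.EllipticCurves.BertoliniDarmonPrasanna2013

set_option autoImplicit false

namespace PNewDisplay

/-! ### §1 An auxiliary pair `(𝔟, b_N)` prime to a given ideal (Chinese remainder theorem) -/

section CRT

variable {R : Type*} [CommRing R] [IsDedekindDomain R]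

/-- **Every ideal class contains an integral ideal prime to a given nonzero ideal**, in the form the
BDP pair (5.1.6) needs: for nonzero ideals `I`, `J` there are `a ≠ 0` and `𝔟` with `𝔟 · I = (a)` and
`𝔟 + J = 1` (induction on the prime factorisation of `I`, one prime at a time by
`ClassGroup.exists_mul_eq_span_and_forall_not_mem`). [cite: NeukirchANT1999, Ch. I §3 (approximation theorem)] -/
theorem exists_mul_eq_span_and_isCoprime (J : Ideal R) (hJ : J ≠ ⊥) :
    ∀ (I : Ideal R), I ≠ ⊥ → ∃ (a : R) (𝔟 : Ideal R), a ≠ 0 ∧ 𝔟 * I = Ideal.span {a} ∧ IsCoprime 𝔟 J := by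
  intro I
  refine UniqueFactorizationMonoid.induction_on_prime I ?_ ?_ ?_
  · intro h; exact absurd rfl h
  · intro u hu _
    have hu' : u = ⊤ := Ideal.isUnit_iff.mp hu
    subst hu'
    refine ⟨1, ⊤, one_ne_zero, by rw [Ideal.span_singleton_one, ← Ideal.one_eq_top, mul_one], ?_⟩
    rw [← Ideal.one_eq_top]
    exact isCoprime_one_left
  · intro a q ha hq ih _
    obtain ⟨a', 𝔟', ha', h𝔟', hcop'⟩ := ih ha
    set v : HeightOneSpectrum R := ⟨q, Ideal.isPrime_of_prime hq, hq.ne_zero⟩ with hv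
    have hJ0 : J ≠ 0 := hJ
    set S : Finset (HeightOneSpectrum R) := (Ideal.finite_factors hJ0).toFinset with hS
    obtain ⟨a₁, 𝔟₁, ha₁, h𝔟₁, havoid⟩ :=
      NumberTheory.NumberFields.ClassGroup.exists_mul_eq_span_and_forall_not_mem v S
    have hcop₁ : IsCoprime 𝔟₁ J := by
      refine Ideal.coprime_of_no_prime_ge fun P h1 h2 hP ↦ ?_
      have hP0 : P ≠ ⊥ := fun h0 ↦ hJ (le_bot_iff.mp (h0 ▸ h2))
      set w : HeightOneSpectrum R := ⟨P, hP, hP0⟩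
      have hwS : w ∈ S := by
        rw [hS, Set.Finite.mem_toFinset]
        exact Ideal.dvd_iff_le.mpr h2
      exact havoid w hwS (Ideal.dvd_iff_le.mpr h1)
    refine ⟨a₁ * a', 𝔟₁ * 𝔟', mul_ne_zero ha₁ ha', ?_, hcop₁.mul_left hcop'⟩
    rw [← Ideal.span_singleton_mul_span_singleton, ← h𝔟₁, ← h𝔟']
    show 𝔟₁ * 𝔟' * (q * a) = v.asIdeal * 𝔟₁ * (𝔟' * a)
    ring

end CRT

/-! ### §2 Uniform convergence of avatars through `κ` from convergence at the generator -/

section Uniform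

variable {p : ℕ} [Fact p.Prime]

/-- A continuous additive character `χ : ℤ_p → ℂ_p` with `‖χ(1) − 1‖ ≤ 1` satisfies `‖χ(a) − 1‖ ≤
‖χ(1) − 1‖` for EVERY `a ∈ ℤ_p` (true on the dense `ℕ ⊂ ℤ_p` since `χ(n) = χ(1)^n`). [folklore] -/
theorem norm_addChar_sub_one_le {χ : AddChar ℤ_[p] ℂ_[p]} (hχ : Continuous χ)
    (h1 : ‖χ 1 - 1‖ ≤ 1) (a : ℤ_[p]) : ‖χ a - 1‖ ≤ ‖χ 1 - 1‖ := by
  have hx : ‖χ 1‖ ≤ 1 := by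
    have h := IsUltrametricDist.norm_add_le_max (χ 1 - 1) (1 : ℂ_[p])
    rw [sub_add_cancel, norm_one] at h
    exact h.trans (max_le h1 le_rfl)
  set S : Set ℤ_[p] := {a | ‖χ a - 1‖ ≤ ‖χ 1 - 1‖} with hS
  have hclosed : IsClosed S := isClosed_le (by fun_prop) continuous_const
  have hnat : Set.range (Nat.cast : ℕ → ℤ_[p]) ⊆ S := by
    rintro _ ⟨n, rfl⟩
    show ‖χ (n : ℤ_[p]) - 1‖ ≤ ‖χ 1 - 1‖
    rw [show (n : ℤ_[p]) = n • (1 : ℤ_[p]) by simp, AddChar.map_nsmul_eq_pow]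
    exact X11b.UnrUnits.norm_pow_sub_one_le hx n
  have hdense : Dense (Set.range (Nat.cast : ℕ → ℤ_[p])) := PadicInt.denseRange_natCast
  have hall : S = Set.univ := by
    apply Set.eq_univ_of_univ_subset
    rw [← hdense.closure_eq]
    exact closure_minimal hnat hclosed
  have ha : a ∈ S := by rw [hall]; exact Set.mem_univ a
  exact ha

variable {K : Type} [Field K] [NumberField K]

/-- **Convergence at the generator is uniform convergence on `Γ_K`** for characters through a
`ℤ_p`-extension: if every `r_k` factors through `κ` and `r_k(γ) → 1` for a topological generator
`γ`, then `r_k → 1` UNIFORMLY on `Γ_K` (each `r_k` is a continuous character `χ_k` of `Γ ≅ ℤ_p` with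
`χ_k(1) = r_k(γ)`, `X11b.Halves.exists_addChar_of_factorsThroughZp`, and `‖χ_k(a) − 1‖ ≤ ‖χ_k(1) − 1‖`).
This is the step from the tree's interpolation sequences (`r_k(γ) → 1`) to convergence `χ_k → 𝐍_K`
in BDP's `Σ̂_cc(𝔑)` (uniform convergence of avatars). [cite: BertoliniDarmonPrasanna2013, §5.2 (p. 61), the topology of Σ̂] -/
theorem eventually_forall_norm_avatarValueAt_sub_one_lt {κ : ZpExtension K p}
    {γ : absoluteGaloisGroup K} (hγ : κ.IsTopGenerator γ)
    {r : ℕ → FramedGaloisRep K (PadicAlgCl p) 1} (hfac : ∀ k, FactorsThroughZp κ (r k))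
    (hlim : Tendsto (fun k ↦ avatarValueAt (r k) γ) atTop (𝓝 1)) {ε : ℝ} (hε : 0 < ε) :
    ∀ᶠ k in atTop, ∀ σ : absoluteGaloisGroup K, ‖avatarValueAt (r k) σ - 1‖ < ε := by
  have hε' : 0 < min ε 1 := lt_min hε one_pos
  have hev : ∀ᶠ k in atTop, ‖avatarValueAt (r k) γ - 1‖ < min ε 1 := by
    have h := Metric.tendsto_nhds.mp hlim (min ε 1) hε'
    simpa only [dist_eq_norm] using h
  filter_upwards [hev] with k hk σ
  obtain ⟨χ, hχc, hχ⟩ := X11b.Halves.exists_addChar_of_factorsThroughZp (hfac k)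
  have h1 : χ 1 = avatarValueAt (r k) γ := by
    have h := hχ γ
    rwa [show κ γ = Multiplicative.ofAdd 1 from hγ, toAdd_ofAdd] at h
  have hle1 : ‖χ 1 - 1‖ ≤ 1 := by rw [h1]; exact (hk.trans_le (min_le_right _ _)).le
  calc ‖avatarValueAt (r k) σ - 1‖ = ‖χ (κ σ).toAdd - 1‖ := by rw [hχ σ]
    _ ≤ ‖χ 1 - 1‖ := norm_addChar_sub_one_le hχc hle1 _
    _ < ε := by rw [h1]; exact hk.trans_le (min_le_left _ _)

end Uniform

/-! ### §3 The values `ι⁻¹(φ_k(𝔟)) → 1` along a uniformly convergent sequence (Frobenius at the primes of `𝔟`) -/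

section IdealValue

variable {p : ℕ} [Fact p.Prime] {K : Type} [Field K] [NumberField K]

omit [NumberField K] in
/-- In rank one, the avatar value at `σ` is the `(0,0)` entry of the matrix `r(σ)`. [folklore] -/
theorem avatarValueAt_eq_entry (r : FramedGaloisRep K (PadicAlgCl p) 1) (σ : absoluteGaloisGroup K) :
    avatarValueAt r σ = ((((r σ : GL (Fin 1) (PadicAlgCl p)) : Matrix (Fin 1) (Fin 1) (PadicAlgCl p)) 0 0
      : PadicAlgCl p) : ℂ_[p]) := by
  rw [avatarValueAt, Matrix.GeneralLinearGroup.val_det_apply, Matrix.det_fin_one]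

/-- **`ι⁻¹(φ_k(ϖ_v)) → 1` at a prime `v ∤ p`** when the avatars `r_k` of the unramified `φ_k` tend to
`1` uniformly: an arithmetic Frobenius `Φ` at `v` has `r_k(Φ) = ι⁻¹(φ_k(ϖ_v))⁻¹` (`IsPAdicAvatarOf`,
rank one), and `r_k(Φ) → 1`. [cite: SerreAbelianLadic1968, Ch. II §2.7 (the avatar at Frobenius)] -/
theorem tendsto_symm_valueAtUniformizer (ι : PadicAlgCl p ≃+* ℂ) {φ : ℕ → HeckeCharacter K}
    {r : ℕ → FramedGaloisRep K (PadicAlgCl p) 1}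
    (hunr : ∀ k (v : HeightOneSpectrum (𝓞 K)), (φ k).IsUnramifiedAt v)
    (hav : ∀ k, IsPAdicAvatarOf ι (φ k) (r k))
    (hunif : ∀ ε : ℝ, 0 < ε → ∀ᶠ k in atTop, ∀ σ : absoluteGaloisGroup K,
      ‖avatarValueAt (r k) σ - 1‖ < ε)
    (v : HeightOneSpectrum (𝓞 K)) (hv : ((p : ℕ) : 𝓞 K) ∉ v.asIdeal) :
    Tendsto (fun k ↦ ((ι.symm ((φ k).valueAtUniformizer v) : PadicAlgCl p) : ℂ_[p])) atTop (𝓝 1) := by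
  obtain ⟨𝔓, h𝔓⟩ := HeightOneSpectrum.primesAbove_nonempty v
  obtain ⟨Φ, hΦ⟩ := HeightOneSpectrum.exists_isArithFrobAt_of_mem_primesAbove_holds h𝔓
  -- `r_k(Φ) = ι⁻¹(φ_k(ϖ_v))⁻¹`
  have hval : ∀ k, avatarValueAt (r k) Φ =
      (((ι.symm ((φ k).valueAtUniformizer v))⁻¹ : PadicAlgCl p) : ℂ_[p]) := by
    intro k
    have h := (hav k v hv (hunr k v)).2
    rw [FramedGaloisRep.hasFrobCharpolyAt_iff_of_rank_one] at h
    rw [avatarValueAt_eq_entry, h 𝔓 h𝔓 Φ hΦ]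
  -- `r_k(Φ) → 1`
  have hΦlim : Tendsto (fun k ↦ avatarValueAt (r k) Φ) atTop (𝓝 1) := by
    rw [Metric.tendsto_nhds]
    intro ε hε
    filter_upwards [hunif ε hε] with k hk
    rw [dist_eq_norm]; exact hk Φ
  have hinv : Tendsto (fun k ↦ (avatarValueAt (r k) Φ)⁻¹) atTop (𝓝 1) := by
    simpa using hΦlim.inv₀ one_ne_zero
  refine hinv.congr fun k ↦ ?_
  rw [hval k, UniformSpace.Completion.coe_inv, inv_inv]

/-- **`ι⁻¹(φ_k(𝔟)) → 1` for an ideal `𝔟` prime to `p`** (finite product over the primes of `𝔟` of the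
previous limits, with their multiplicities). [cite: BertoliniDarmonPrasanna2013, §5.2 (p. 61) (continuity of χ ↦ χ(𝔞), 𝔞 prime to p)] -/
theorem tendsto_symm_heckeIdealValue (ι : PadicAlgCl p ≃+* ℂ) {φ : ℕ → HeckeCharacter K}
    {r : ℕ → FramedGaloisRep K (PadicAlgCl p) 1}
    (hunr : ∀ k (v : HeightOneSpectrum (𝓞 K)), (φ k).IsUnramifiedAt v)
    (hav : ∀ k, IsPAdicAvatarOf ι (φ k) (r k))
    (hunif : ∀ ε : ℝ, 0 < ε → ∀ᶠ k in atTop, ∀ σ : absoluteGaloisGroup K,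
      ‖avatarValueAt (r k) σ - 1‖ < ε)
    {𝔟 : Ideal (𝓞 K)} (h𝔟 : 𝔟 ≠ ⊥)
    (h𝔟p : ∀ v : HeightOneSpectrum (𝓞 K), v.asIdeal ∣ 𝔟 → ((p : ℕ) : 𝓞 K) ∉ v.asIdeal) :
    Tendsto (fun k ↦ ((ι.symm (heckeIdealValueExtZero (φ k) 𝔟) : PadicAlgCl p) : ℂ_[p])) atTop
      (𝓝 1) := by
  have h𝔟0 : 𝔟 ≠ 0 := h𝔟
  set T : Finset (HeightOneSpectrum (𝓞 K)) := (Ideal.finite_factors h𝔟0).toFinset with hT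
  have hTmem : ∀ v : HeightOneSpectrum (𝓞 K), v.asIdeal ∣ 𝔟 → v ∈ T := fun v hv ↦ by
    rw [hT, Set.Finite.mem_toFinset]; exact hv
  have hmemT : ∀ v ∈ T, v.asIdeal ∣ 𝔟 := fun v hv ↦ by
    rw [hT, Set.Finite.mem_toFinset] at hv; exact hv
  set e : ℂ →+* ℂ_[p] := (algebraMap (PadicAlgCl p) ℂ_[p]).comp ι.symm.toRingHom with he
  have he' : ∀ z : ℂ, ((ι.symm z : PadicAlgCl p) : ℂ_[p]) = e z := fun z ↦ rfl
  simp_rw [he', heckeIdealValueExtZero_eq_prod _ h𝔟 T hTmem, map_prod, map_pow]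
  rw [show (1 : ℂ_[p]) = ∏ v ∈ T, (1 : ℂ_[p]) ^
      ((Associates.mk v.asIdeal).count (Associates.mk 𝔟).factors) by simp]
  refine tendsto_finsetProd T fun v hv ↦ Tendsto.pow ?_ _
  have hlim := tendsto_symm_valueAtUniformizer ι hunr hav hunif v (h𝔟p v (hmemT v hv))
  refine hlim.congr fun k ↦ ?_
  rw [← he', heckeValueExtZero_of_isUnramifiedAt (hunr k v)]

end IdealValue

end PNewDisplay

namespace PNewDisplay

/-! ### §4 The exact rescaling: BDP's display = Castella's display with a virtual period, times a constant and `φ(𝔟)⁻¹` -/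

section Rescale

variable {K : Type} [Field K] [NumberField K] {N : ℕ}

/-- **BDP's `(1 − a_p p⁻¹φ(𝔭))²·L_alg(f,χ⁻¹,0)` equals Castella's display `bdpInterpolationValue` at the
VIRTUAL complex period `Ω_K′`, `Ω_K′⁴ = Ω⁴·N𝔟·(−N₀)·|d_K|/(4π⁴ b_N²)`, times the constant
`g/(w_f·φ(𝔟))`, `g = (1/4)·w_K·|d_K|^{1/2}·2^{#S(f)}`** (k5-c4-MEMO-1 (B2) in the kernel): all
`n`-th powers — `π^{4n}`, `(4/|d_K|)^n`, `(N𝔟(−N₀)/b_N²)^{−n}`, `(Ω_K′/Ω)^{4n}` — are absorbed EXACTLY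
by the choice of `Ω_K′` (BDP Rem. 5.6 / 5.8), and the Γ-factors `Γ(n)Γ(n+1)` match.
[cite: BertoliniDarmonPrasanna2013, Thm. 4.6, (5.1.11), Thm. 5.5, Rem. 5.6 and Rem. 5.8]
[cite: Castella2018, Thm. 3.1 (arXiv:1704.06608 p. 9) (the display bdpInterpolationValue)] -/
theorem eulerSq_mul_bdpLalg_eq {p : ℕ} (hpN : p ∣ N) (f : CuspForm (Gamma0 N) 2)
    (𝔭 : HeightOneSpectrum (𝓞 K)) (sf : ℕ) (wf : ℂ) (𝔟 : Ideal (𝓞 K)) (N₀ : ℕ) (bN Ω ΩK' : ℂ)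
    (φ : HeckeCharacter K) {n : ℕ} (hn : 0 < n) (hwf : wf ≠ 0)
    (hφb : heckeIdealValueExtZero φ 𝔟 ≠ 0) (hNb : ((Ideal.absNorm 𝔟 : ℕ) : ℂ) ≠ 0)
    (hN₀ : (N₀ : ℂ) ≠ 0) (hbN : bN ≠ 0) (hΩ : Ω ≠ 0)
    (hroot : ΩK' ^ 4 = Ω ^ 4 * ((Ideal.absNorm 𝔟 : ℕ) : ℂ) * (-(N₀ : ℂ)) *
      ((|(NumberField.discr K : ℝ)| : ℝ) : ℂ) / (4 * (Real.pi : ℂ) ^ 4 * bN ^ 2)) :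
    (1 - cuspCoeff f p * ((p : ℂ))⁻¹ * heckeValueExtZero φ 𝔭) ^ 2 * bdpLalg f sf wf 𝔟 N₀ bN Ω φ n =
      bdpInterpolationValue p f 𝔭 φ n ΩK' *
        (((1 / 4 : ℂ) * (Units.torsionOrder K : ℂ) * (Real.sqrt |(NumberField.discr K : ℝ)| : ℂ) *
          (2 : ℂ) ^ sf) / (wf * heckeIdealValueExtZero φ 𝔟)) := by
  obtain ⟨m, rfl⟩ : ∃ m, n = m + 1 := ⟨n - 1, by omega⟩
  rw [bdpInterpolationValue_of_dvd hpN]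
  unfold bdpLalg bdpConstC bdpConstW
  -- abbreviations (atoms of the identity)
  set E : ℂ := 1 - cuspCoeff f p * ((p : ℂ))⁻¹ * heckeValueExtZero φ 𝔭 with hE
  set L : ℂ := rankinSelbergValueHecke f φ 1 with hL
  set G₁ : ℂ := Complex.Gamma ((m + 1 : ℕ) : ℂ) with hG₁
  set G₂ : ℂ := Complex.Gamma (((m + 1 : ℕ) : ℂ) + 1) with hG₂
  set wK : ℂ := (Units.torsionOrder K : ℂ) with hwK
  set s : ℂ := (Real.sqrt |(NumberField.discr K : ℝ)| : ℂ) with hs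
  set φb : ℂ := heckeIdealValueExtZero φ 𝔟 with hφb_def
  set Nb : ℂ := ((Ideal.absNorm 𝔟 : ℕ) : ℂ) with hNb_def
  set π : ℂ := (Real.pi : ℂ) with hπ
  set q : ℂ := -(N₀ : ℂ) with hq
  have hπ0 : π ≠ 0 := by rw [hπ]; exact_mod_cast Real.pi_ne_zero
  have hs2 : s ^ 2 = ((|(NumberField.discr K : ℝ)| : ℝ) : ℂ) := by
    rw [hs, ← Complex.ofReal_pow, Real.sq_sqrt (abs_nonneg _)]
  have hd0 : ((|(NumberField.discr K : ℝ)| : ℝ) : ℂ) ≠ 0 := by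
    have h : (NumberField.discr K : ℝ) ≠ 0 := by exact_mod_cast NumberField.discr_ne_zero K
    exact_mod_cast (abs_ne_zero.mpr h)
  have hs0 : s ≠ 0 := fun h ↦ hd0 (by rw [← hs2, h]; ring)
  have hq0 : q ≠ 0 := neg_ne_zero.mpr hN₀
  -- integer / natural exponents
  have hsub : 2 * (m + 1) - 1 = 2 * m + 1 := by omega
  rw [hsub]
  have hz1 : (s / 2) ^ (-(2 * ((m + 1 : ℕ) : ℤ))) = ((s / 2) ^ (2 * (m + 1)))⁻¹ := by
    rw [zpow_neg, show (2 * ((m + 1 : ℕ) : ℤ)) = ((2 * (m + 1) : ℕ) : ℤ) by push_cast; ring,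
      zpow_natCast]
  have hz2 : bN ^ (-(2 * ((m + 1 : ℕ) : ℤ))) = (bN ^ (2 * (m + 1)))⁻¹ := by
    rw [zpow_neg, show (2 * ((m + 1 : ℕ) : ℤ)) = ((2 * (m + 1) : ℕ) : ℤ) by push_cast; ring,
      zpow_natCast]
  rw [hz1, hz2]
  -- every power as a power of an atom with exponent `m + 1` (or a numeral)
  have hK4 : ΩK' ^ (4 * (m + 1)) =
      (Ω ^ 4) ^ (m + 1) * Nb ^ (m + 1) * q ^ (m + 1) * (s ^ 2) ^ (m + 1) /
        ((4 : ℂ) ^ (m + 1) * (π ^ 4) ^ (m + 1) * (bN ^ 2) ^ (m + 1)) := by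
    rw [pow_mul, hroot, ← hs2]
    simp only [div_pow, mul_pow]
  have hΩ4 : Ω ^ (4 * (m + 1)) = (Ω ^ 4) ^ (m + 1) := by rw [pow_mul]
  have hbN2 : bN ^ (2 * (m + 1)) = (bN ^ 2) ^ (m + 1) := by rw [pow_mul]
  have hs22 : (s / 2) ^ (2 * (m + 1)) = (s ^ 2) ^ (m + 1) / (4 : ℂ) ^ (m + 1) := by
    rw [pow_mul, show (s / 2) ^ 2 = s ^ 2 / 4 by ring, div_pow]
  have hπa : π ^ (2 * m + 1) = (π ^ 2) ^ m * π := by rw [pow_succ, pow_mul]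
  have hπb : π ^ (2 * (m + 1) + 1) = (π ^ 2) ^ m * π ^ 3 := by
    rw [show 2 * (m + 1) + 1 = 2 * m + 3 by ring, pow_add, pow_mul]
  have hπ4 : (π ^ 4) ^ (m + 1) = (π ^ 2) ^ m * (π ^ 2) ^ m * π ^ 4 := by
    rw [← pow_mul, ← pow_mul, ← pow_add, ← pow_add]; ring_nf
  rw [hK4, hΩ4, hbN2, hs22, hπa, hπb, hπ4]
  have h2 : (2 : ℂ) ≠ 0 := two_ne_zero
  have h4 : (4 : ℂ) ≠ 0 := by norm_num
  field_simp

end Rescale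

/-! ### §5 Units: the leftover constant `g/w_f` is a `p`-adic unit at an odd split `p` -/

section Units

variable {p : ℕ} [Fact p.Prime]

/-- The embedding `e = ι⁻¹ : ℂ → ℚ̄_p ⊂ ℂ_p` sends a natural number prime to `p` to a `p`-adic unit.
[folklore] -/
theorem norm_map_natCast_eq_one (e : ℂ →+* ℂ_[p]) {n : ℕ} (hn : ¬ p ∣ n) :
    ‖e (n : ℂ)‖ = 1 := by
  have hp : p.Prime := Fact.out
  rw [map_natCast, show (n : ℂ_[p]) = ((n : ℚ_[p]) : ℂ_[p]) by simp, PadicComplex.norm_extends',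
    Padic.norm_natCast_eq_one_iff]
  exact (Nat.Prime.coprime_iff_not_dvd hp).mpr hn

/-- `‖e(|d_K|^{1/2})‖ = 1` when `p ∤ d_K`: its square is `e(|d_K|)`, a `p`-adic unit. [folklore] -/
theorem norm_map_sqrt_discr_eq_one (e : ℂ →+* ℂ_[p]) {d : ℤ} (hd : ¬ (p : ℤ) ∣ d) :
    ‖e (Real.sqrt |(d : ℝ)| : ℂ)‖ = 1 := by
  have hsq : ‖e (Real.sqrt |(d : ℝ)| : ℂ)‖ ^ 2 = 1 := by
    have hcast : ((|(d : ℝ)| : ℝ) : ℂ) = ((d.natAbs : ℕ) : ℂ) := by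
      rw [Nat.cast_natAbs, ← Complex.ofReal_intCast, Int.cast_abs]
    rw [← norm_pow, ← map_pow, ← Complex.ofReal_pow, Real.sq_sqrt (abs_nonneg _), hcast]
    exact norm_map_natCast_eq_one e (fun h ↦ hd (Int.natCast_dvd.mpr h))
  have h0 : 0 ≤ ‖e (Real.sqrt |(d : ℝ)| : ℂ)‖ := norm_nonneg _
  nlinarith [hsq, h0, sq_nonneg (‖e (Real.sqrt |(d : ℝ)| : ℂ)‖ - 1)]

end Units

end PNewDisplay

end Summit.BirchSwinnertonDyer.Rank1Residual.X2

end
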